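import Summits.CriticalPhenomena.Ising3DConformalLimit.Theorems.MonotoneBlockingNonSeparableModulusAxialPincer
import Summits.CriticalPhenomena.Ising3DConformalLimit.Theorems.MonotoneBlockingNonSeparableModulusOfSiblingCruxes
import Summits.CriticalPhenomena.Ising3DConformalLimit.Theorems.BernsteinTemperatureKernelTransferEdge
import Literature.Probability.LatticeModels.IsingThermodynamics
import HarnessLib

/-!
# Strategist r1 sketch — crux `NonSeparableModulus` (NS, item stmt-CriticalPhenomena-6152), route MonotoneBlocking

Typed companions of `STRATEGY-CENSUS.md` Part B (seat planner-cstrat-stmt-CriticalPhenomena-6152-r1-0).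

Since the b1 census the tree has LANDED `nonSeparableModulus_iff_twoPointDoubling : NS ↔ TwoPointDoubling`
(item 6152 ⟺ item 6150, p159449) and `nonSeparableModulus_of_monotoneBlockingTwo : BM₂ → NS` (p163559).
So every transfer / strengthening / split of NS is one of 6150 (all-scale axial doubling of
`g(n) = ⟨σ₀σ_{ne₀}⟩⁺_{β_c(3)}`).  The signatures below are the r1 inventory (subcritical side,
supercritical side, octave-ratio monotonicity in `β`); each is shown to FEED 6150 (hence NS) by a
kernel-checked composition, and the census records where each breaks.

* `SubcriticalUniformDoubling` — doubling below the correlation length, uniformly in `β < β_c` (T-r1-2).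
* `OctaveRatioMonotoneInBeta` — `β ↦ g_β(2n)/g_β(n)` non-decreasing on `[0, β_c]` (S-r1-1).
* `SupercriticalPlateauMatching` — amplitude matching `g_β(n) ≍ m*(β)² ≍ g(2n)` for some `β > β_c` (T-r1-3);
  `twoPointDoubling_of_supercriticalPlateauMatching` — PROVED (monotonicity in `β`), so this strengthening is a
  hyperscaling identity in disguise.
* `nonSeparableModulus_of_supercriticalPlateauMatching` — the composition down to the crux BY NAME.
-/

noncomputable section

namespace Summit.CriticalPhenomena.Ising3DConformalLimit.Cruxes.NonSeparableModulus.StrategistR1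

open Literature.Probability.LatticeModels
open Summit.CriticalPhenomena.Ising3DConformalLimit.Theses
open Summit.CriticalPhenomena.Ising3DConformalLimit.Theorems.KernelTransfer (twoPointPlus_mono)

/-! ## Shorthand -/

/-- `g_β(n) = ⟨σ₀σ_{n e₀}⟩⁺_{β,0}` on `ℤ³`. -/
def gβ (β : ℝ) (n : ℕ) : ℝ := twoPointPlus 3 β (Pi.single 0 (n : ℤ))

/-- `g(n) = ⟨σ₀σ_{n e₀}⟩⁺_{β_c(3),0}`. -/
def g (n : ℕ) : ℝ := criticalTwoPoint 3 (Pi.single 0 (n : ℤ))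

theorem g_eq_gβ (n : ℕ) : g n = gβ (criticalBeta 3) n := rfl

/-! ## T-r1-2: the subcritical sibling — doubling below the correlation length, uniformly in `β < β_c` -/

/-- **SubcriticalUniformDoubling** (transfer target of T-r1-2): there is `κ > 0` such that for every
`0 ≤ β < β_c(3)` and every `n ≥ 1` with `2n ≤ ξ(β)` (the plus-state axial correlation length),
`κ·g_β(n) ≤ g_β(2n)`.  It implies 6150 by letting `β ↑ β_c` (left-continuity of the free = plus
two-point function at `β_c`, `ξ(β) → ∞`); no subcritical tool acts below `ξ(β)` (census T-r1-2). -/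
def SubcriticalUniformDoubling : Prop :=
  ∃ κ : ℝ, 0 < κ ∧ ∀ β : ℝ, 0 ≤ β → β < criticalBeta 3 →
    ∀ n : ℕ, 1 ≤ n → ((2 * n : ℕ) : ℝ) ≤ isingCorrLength 3 β → κ * gβ β n ≤ gβ β (2 * n)

/-! ## S-r1-1: monotonicity of the octave ratio in `β` -/

/-- **OctaveRatioMonotoneInBeta** (S-r1-1): for every `n ≥ 1` the octave ratio
`β ↦ g_β(2n)/g_β(n)` is non-decreasing on `[0, β_c(3)]`.  An unproved four-point correlation
inequality (`∂_β log g_β(2n) ≥ ∂_β log g_β(n)`); even granted it only gives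
`g(2n)/g(n) ≥ sup_{β<β_c} g_β(2n)/g_β(n)`, i.e. it reduces 6150 to `SubcriticalUniformDoubling`. -/
def OctaveRatioMonotoneInBeta : Prop :=
  ∀ n : ℕ, 1 ≤ n → MonotoneOn (fun β : ℝ => gβ β (2 * n) / gβ β n) (Set.Icc 0 (criticalBeta 3))

/-! ## T-r1-3: the supercritical side — plateau matching -/

/-- **SupercriticalPlateauMatching** (T-r1-3): for every scale `n` some `β > β_c` has
`g_β(n) ≤ C·m*(β)²` and `m*(β)² ≤ C·g(2n)` — the long-range-order plateau of the `+` state at a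
temperature with `ξ⁺(β) ≍ n` matches the critical two-point function at scale `2n` (amplitude form
of `2β/ν = 1 + η`).  With monotonicity in `β` it gives 6150 at once (next theorem). -/
def SupercriticalPlateauMatching : Prop :=
  ∃ C : ℝ, 0 < C ∧ ∀ n : ℕ, 1 ≤ n → ∃ β : ℝ, criticalBeta 3 < β ∧
    gβ β n ≤ C * (spontaneousMagnetization 3 β) ^ 2 ∧
    (spontaneousMagnetization 3 β) ^ 2 ≤ C * g (2 * n)

/-- **T-r1-3 ⟹ 6150**: `g(n) ≤ g_β(n) ≤ C m*(β)² ≤ C² g(2n)`, so `κ = C⁻²`. -/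
theorem twoPointDoubling_of_supercriticalPlateauMatching (h : SupercriticalPlateauMatching) :
    MirrorHoelderCompactness.TwoPointDoubling := by
  obtain ⟨C, hC, hall⟩ := h
  refine ⟨(C ^ 2)⁻¹, by positivity, fun n hn => ?_⟩
  obtain ⟨β, hβc, h1, h2⟩ := hall n hn
  -- monotonicity in β: g(n) = g_{β_c}(n) ≤ g_β(n)
  have hmono : g n ≤ gβ β n := by
    rw [g_eq_gβ]
    exact twoPointPlus_mono (criticalBeta_nonneg (d := 3)) hβc.le _
  have hchain : g n ≤ C ^ 2 * g (2 * n) := by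
    calc g n ≤ gβ β n := hmono
      _ ≤ C * spontaneousMagnetization 3 β ^ 2 := h1
      _ ≤ C * (C * g (2 * n)) := by gcongr
      _ = C ^ 2 * g (2 * n) := by ring
  have hC2 : 0 < C ^ 2 := by positivity
  have key : (C ^ 2)⁻¹ * g n ≤ g (2 * n) := by
    rw [inv_mul_le_iff₀ hC2]
    exact hchain
  simpa [g, Nat.cast_mul] using key

/-- **… ⟹ NS** (the crux BY NAME), through the landed `NS ↔ 6150`. -/
theorem nonSeparableModulus_of_supercriticalPlateauMatching (h : SupercriticalPlateauMatching) :
    MonotoneBlocking.NonSeparableModulus :=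
  MonotoneBlockingNonSeparableModulusAxialPincer.nonSeparableModulus_iff_twoPointDoubling.2
    (twoPointDoubling_of_supercriticalPlateauMatching h)

/-! ## The alias, recorded once more at this seat (all landed) -/

/-- 6152 ⟺ 6150 (p159449). -/
theorem alias_6152_6150 :
    MonotoneBlocking.NonSeparableModulus ↔ MirrorHoelderCompactness.TwoPointDoubling :=
  MonotoneBlockingNonSeparableModulusAxialPincer.nonSeparableModulus_iff_twoPointDoubling

/-- 17054 ⟹ 6152 (p163559): NS is not load-bearing in route `MonotoneBlocking`. -/
theorem ns_of_bm2 : MonotoneBlocking.MonotoneBlockingTwo → MonotoneBlocking.NonSeparableModulus :=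
  MonotoneBlockingNonSeparableModulusOfSiblingCruxes.nonSeparableModulus_of_monotoneBlockingTwo

/-- Route `MonotoneBlocking` closes from BM₂, BM_mom, LAC alone (p163559) — the `--drop NonSeparableModulus` glue. -/
theorem monotoneBlocking_closes_min
    (hBM2 : MonotoneBlocking.MonotoneBlockingTwo) (hBMM : MonotoneBlocking.MonotoneBlockingMoments)
    (hLAC : MonotoneBlocking.LimitsAreConformal) : _root_.Ising3DConformalLimit :=
  MonotoneBlockingNonSeparableModulusOfSiblingCruxes.monotoneBlocking_closes_min hBM2 hBMM hLAC

end Summit.CriticalPhenomena.Ising3DConformalLimit.Cruxes.NonSeparableModulus.StrategistR1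

end
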